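import Mathlib
import Summits.NavierStokesRegularity.NavierStokesRegularity.Theorems.EulerZoomLiouvillePowerGaugeEulerLiouvilleStretchingBudgetStarvationFree
import Summits.NavierStokesRegularity.NavierStokesRegularity.Theorems.EulerZoomLiouvillePowerGaugeEulerLiouvilleStretchingBudgetFloorTransportFree
import Summits.NavierStokesRegularity.NavierStokesRegularity.Theorems.EulerZoomLiouvillePowerGaugeEulerLiouvillePastIrrotational
import HarnessLib

/-!
# Crux `EulerZoomLiouville.PowerGaugeEulerLiouville` (stmt-NavierStokesRegularity-19832), line `stretching-budget` rev4:
# THE GRADIENT-FREE STRATUM THEOREM — a classical member with a drifting far past and a sub-threshold stretching budget is trivial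

Route №10 `EulerZoomLiouville` (NavierStokesRegularity), crux E.  Line `stretching-budget` (ideator ns-idea-11 g4;
`Cruxes/PowerGaugeEulerLiouville/Lines/stretching_budget.lean` rev4 8cfa8ef277cf).  The line's composition `K1 → K2 → K3 → crux` minus the OPEN
residue K3, at MEMBER level, in the GRADIENT-FREE text (rev2/rev4 `IsDriftingPastWith`: classical, `T₁ ≤ 0`, `0 ≤ M`, `κ < 1`, velocity
envelope — NOTHING on the gradient): K1′ (`floorBlobsPersist_of_driftingPast_free`, cutoff-field flow) feeds K2′
(`pastCurlFree_of_floorBlobsPersist_free`), which makes `(−∞,T₁)` irrotational; the LEAD's landed filler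
`PastIrrotational.ae_eq_zero_of_gauge_of_pastIrrotational` concludes.  This supersedes the rev1 SUB-stratum theorem
`ae_eq_zero_of_gauge_of_stretchingBudgeted` (ns-in-ser-c g2, p630534), which carried the clause «`∇u` bounded on compact time sets, uniformly in `x`».

* **`ae_eq_zero_of_gauge_of_stretchingBudgeted_free`** — crux hypotheses verbatim + the stratum hypothesis `IsStretchingBudgeted ρ u p` (rev4,
  gradient-free) `δ`-unfolded; one-name filler for the line file's `stretchingBudgeted_vanishes`/`stub_stretchingBudgeted` wiring.

HONEST LABEL (the card's): a STRATUM theorem — general 3D, no symmetry, no self-similarity, no Type-I rate, no gradient hypothesis at all; the price is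
the velocity envelope and `K₀ ≤ 3/8`; every putative self-similar member has stretching rate `≥ 1/(−τ)` along vortical paths and sits OUTSIDE.
WHAT THIS IS NOT: not NS, not the crux — `--supports` stmt-19832; the residue K3 `stub_budgetRest` is OPEN and not claimed; crux 19832, rung N0 and
NS regularity stay OPEN; no summit statement is proved here.  [cite: MajdaBertozziCUP2002, §1.6 (1.50)–(1.51); Chae2010, Thm 1.1]
-/

noncomputable section

-- flat `Theorems/<Route><Decl>…` files of one crux share the namespace of the crux (tree convention)
set_option linter.dupNamespace false

open MeasureTheory Set Filter Topology Metric Function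
open scoped NNReal ENNReal RealInnerProductSpace

namespace Summit.NavierStokesRegularity.NavierStokesRegularity.Theorems.PowerGaugeEulerLiouville.StretchingBudget

open Literature.Analysis Literature.Analysis.FluidPDE

/-- **The GRADIENT-FREE `stretching-budget` stratum of crux E is trivial** (member level; crux hypotheses verbatim, stratum hypothesis
`IsStretchingBudgeted ρ u p` (rev4) unfolded): for `0 < ρ ≤ 1/2`, a member `(u,p,H,c)` of Seregin's power-gauged ancient Euler class that is
classical on `(−∞,0)` with a drifting far past `(T₁, M, κ)` (velocity envelope `M(−τ)^{−κ}`, `κ < 1`; NO gradient hypothesis) and a stretching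
budget `(K, Λ)` with `0 ≤ K < min((1+ρ)/4, (κ+ρ−κρ)/2)` vanishes a.e. on the past slab.
[cite: MajdaBertozziCUP2002, §1.6 (1.50)–(1.51); Chae2010, Thm 1.1 (proof display)] -/
theorem ae_eq_zero_of_gauge_of_stretchingBudgeted_free {ρ : ℝ} (hρ : 0 < ρ) (hρ2 : ρ ≤ 1 / 2)
    {u : ℝ → EuclideanSpace ℝ (Fin 3) → EuclideanSpace ℝ (Fin 3)} {p : ℝ → EuclideanSpace ℝ (Fin 3) → ℝ}
    {H : ℝ → EuclideanSpace ℝ (Fin 3) → EuclideanSpace ℝ (Fin 3) →L[ℝ] EuclideanSpace ℝ (Fin 3)} {c : ℝ≥0}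
    (hsw : IsSuitableWeakSolutionOn (slab (EuclideanSpace ℝ (Fin 3)) (Set.Iio 0) isOpen_Iio) 0 0 u p)
    (hH : HasWeakSpatialGradientOn (slab (EuclideanSpace ℝ (Fin 3)) (Set.Iio 0) isOpen_Iio) u H)
    (hc : ∀ a : ℝ, 0 < a →
      ENNReal.ofReal (a ^ (2 * ρ)) * cknA a (0 : ℝ × EuclideanSpace ℝ (Fin 3)) u +
          ENNReal.ofReal (a ^ ρ) * cknE a (0 : ℝ × EuclideanSpace ℝ (Fin 3)) H +
        ENNReal.ofReal (a ^ (2 * ρ)) * cknD a (0 : ℝ × EuclideanSpace ℝ (Fin 3)) p ≤ (c : ℝ≥0∞))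
    (hstratum : ∃ T₁ M κ K : ℝ, ∃ Λ : ℝ → ℝ,
      (IsClassicalEulerSolutionOn (Set.Iio 0) 0 u p ∧ T₁ ≤ 0 ∧ 0 ≤ M ∧ κ < 1 ∧
          (∀ τ : ℝ, τ < T₁ → ∀ x : EuclideanSpace ℝ (Fin 3), ‖u τ x‖ ≤ M * (-τ) ^ (-κ))) ∧
        0 ≤ K ∧ K < min ((1 + ρ) / 4) ((κ + ρ - κ * ρ) / 2) ∧
        (IntegrableOn Λ (Set.Iio T₁) ∧ (∀ τ : ℝ, 0 ≤ Λ τ) ∧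
          ∀ τ : ℝ, τ < T₁ → ∀ x : EuclideanSpace ℝ (Fin 3),
            ⟪fderiv ℝ (u τ) x (curl (u τ) x), curl (u τ) x⟫ ≤ (K / (-τ) + Λ τ) * ‖curl (u τ) x‖ ^ 2)) :
    Function.uncurry u =ᵐ[volume.restrict (Set.Iio (0 : ℝ) ×ˢ (Set.univ : Set (EuclideanSpace ℝ (Fin 3))))] 0 := by
  obtain ⟨T₁, M, κ, K, Λ, hD, hK0, hK, hB⟩ := hstratum
  have hcurl : ∀ τ : ℝ, τ < T₁ → ∀ x : EuclideanSpace ℝ (Fin 3), curl (u τ) x = 0 :=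
    pastCurlFree_of_floorBlobsPersist_free ρ hρ hρ2 u p H c ⟨hsw, hH, hc⟩ T₁ M κ K Λ hD hK0 hK hB
      (floorBlobsPersist_of_driftingPast_free u p T₁ M κ K Λ hD hK0 hB)
  have hcl : IsClassicalEulerSolutionOn (Set.Iio 0) 0 u p := hD.1
  have hT₁ : T₁ ≤ 0 := hD.2.1
  have hmem : ∀ τ : ℝ, τ < T₁ → τ ∈ Set.Iio (0 : ℝ) := fun τ hτ => lt_of_lt_of_le hτ hT₁
  exact PastIrrotational.ae_eq_zero_of_gauge_of_pastIrrotational hρ hρ2 hsw hH hc hT₁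
    (fun τ hτ => (hcl.contDiff_velocity (hmem τ hτ)).of_le (by norm_cast))
    (fun τ hτ => hcl.divFree τ (hmem τ hτ)) hcurl

/-- **«ANCIENT MEMBERS ARE BORN BY AN INFINITE ACCUMULATED POSITIVE STRETCHING» — the `K = 0` member, gradient-free**: for `0 < ρ ≤ 1/2`, a member of
the class with a drifting classical far past `(T₁, M, κ)`, `κ < 1` (if `κ ≤ −ρ/(1−ρ)` the threshold is non-positive and the statement is void —
so assume `−ρ/(1−ρ) < κ`), whose positive stretching rate is INTEGRABLE at `−∞` — `⟪∇u ω, ω⟫ ≤ Λ(τ)|ω|²`, `Λ ≥ 0`, `∫_{(−∞,T₁)} Λ < ∞` — vanishes a.e.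
[cite: Chae2010, Thm 1.1] -/
theorem ae_eq_zero_of_gauge_of_integrableStretching_free {ρ : ℝ} (hρ : 0 < ρ) (hρ2 : ρ ≤ 1 / 2)
    {u : ℝ → EuclideanSpace ℝ (Fin 3) → EuclideanSpace ℝ (Fin 3)} {p : ℝ → EuclideanSpace ℝ (Fin 3) → ℝ}
    {H : ℝ → EuclideanSpace ℝ (Fin 3) → EuclideanSpace ℝ (Fin 3) →L[ℝ] EuclideanSpace ℝ (Fin 3)} {c : ℝ≥0}
    (hsw : IsSuitableWeakSolutionOn (slab (EuclideanSpace ℝ (Fin 3)) (Set.Iio 0) isOpen_Iio) 0 0 u p)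
    (hH : HasWeakSpatialGradientOn (slab (EuclideanSpace ℝ (Fin 3)) (Set.Iio 0) isOpen_Iio) u H)
    (hc : ∀ a : ℝ, 0 < a →
      ENNReal.ofReal (a ^ (2 * ρ)) * cknA a (0 : ℝ × EuclideanSpace ℝ (Fin 3)) u +
          ENNReal.ofReal (a ^ ρ) * cknE a (0 : ℝ × EuclideanSpace ℝ (Fin 3)) H +
        ENNReal.ofReal (a ^ (2 * ρ)) * cknD a (0 : ℝ × EuclideanSpace ℝ (Fin 3)) p ≤ (c : ℝ≥0∞))
    {T₁ M κ : ℝ} {Λ : ℝ → ℝ} (hcl : IsClassicalEulerSolutionOn (Set.Iio 0) 0 u p) (hT₁ : T₁ ≤ 0) (hM : 0 ≤ M) (hκ : κ < 1)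
    (hκρ : 0 < min ((1 + ρ) / 4) ((κ + ρ - κ * ρ) / 2))
    (henv : ∀ τ : ℝ, τ < T₁ → ∀ x : EuclideanSpace ℝ (Fin 3), ‖u τ x‖ ≤ M * (-τ) ^ (-κ))
    (hΛi : IntegrableOn Λ (Set.Iio T₁)) (hΛ0 : ∀ τ : ℝ, 0 ≤ Λ τ)
    (hbud : ∀ τ : ℝ, τ < T₁ → ∀ x : EuclideanSpace ℝ (Fin 3),
      ⟪fderiv ℝ (u τ) x (curl (u τ) x), curl (u τ) x⟫ ≤ Λ τ * ‖curl (u τ) x‖ ^ 2) :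
    Function.uncurry u =ᵐ[volume.restrict (Set.Iio (0 : ℝ) ×ˢ (Set.univ : Set (EuclideanSpace ℝ (Fin 3))))] 0 := by
  refine ae_eq_zero_of_gauge_of_stretchingBudgeted_free hρ hρ2 hsw hH hc
    ⟨T₁, M, κ, 0, Λ, ⟨hcl, hT₁, hM, hκ, henv⟩, le_rfl, hκρ, hΛi, hΛ0, fun τ hτ x => ?_⟩
  rw [zero_div, zero_add]
  exact hbud τ hτ x

end Summit.NavierStokesRegularity.NavierStokesRegularity.Theorems.PowerGaugeEulerLiouville.StretchingBudget

end
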